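import Mathlib
import HarnessLib
import Literature.Analysis.FluidPDE.MildAncientTimeDecayRegularity
import Summits.NavierStokesRegularity.NavierStokesRegularity.Theorems.PoloidalWindowDoorLrcModEntireRidgeClass
import Summits.NavierStokesRegularity.NavierStokesRegularity.Theorems.PoloidalWindowDoorLrcModEntireRidgeGlobalBranchLocal

/-!
# Item `LrcModEntire` (stmt-NavierStokesRegularity-20428) — BRANCH-PARAM, parts 5–6: THE COMPLETE UNIT-SPEED HOT BRANCH through a non-degenerate hot point (class-free and binder level)

LEAD of item 20428 ns-poloidal-K2-p3 g15 (`--supports stmt-NavierStokesRegularity-20428 --as helper`).  Memo `Cruxes/LrcModEntire/T2B-g14.md` §13b; port-2 g5's open point (ii)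
BRANCH-PARAM.  Class-free statement: `f : ℝ³ → ℝ` analytic with bounded `D²f, D³f, D⁴f` (KNSS slice bounds in the application `f = σ v₂(−1,·)`), hot set `H = {y₂ = 0, f = M}` with
`0 ∈ H`, every hot point critical, of horizontal Laplacian `−κ ≠ 0` (ridge law), and NOT ISOLATED in `H` (no compact isolated hot piece).  Then

* `exists_kernel_direction` — at every hot point there is a horizontal unit `T` with `D²f(y)[T,·] = 0` (limit of secants to nearby hot points);
* `exists_complete_hotBranch` — **there is a `C²` unit-speed curve `γ : ℝ → H` with `γ 0 = 0`, horizontal, hot for ALL `s ∈ ℝ`, with `D²f(γ s)[γ′ s, ·] = 0` and normal curvature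
  `D²f(γ s)[Jγ′ s, Jγ′ s] = −κ`** — the global solution of the hot-branch ODE (`…RidgeGlobalBranchODE.exists_global_solution`) through `(0, T₀)`, which stays good for all times by
  a clopen argument on `ℝ`: the good set is closed (continuity) and open (local good solutions `…RidgeGlobalBranchFlow.exists_local_good_solution` + ODE uniqueness
  `…RidgeGlobalBranchODE.eqOn_of_solutions`).

* `exists_complete_hotBranch_of_ridge` — BINDER LEVEL at `f = σ·v₂(−1,·)`: class clauses + `hcrit` + «no compact isolated hot piece» (clauses of `stub_T2b` VERBATIM) + the ridge
  law in nested currency `D²(σv₂)(y)[e₀,e₀] + [e₁,e₁] = −κ` on the hot set, `κ ≠ 0` ⇒ `γ` in port-2's currency (`ν = ![−γ′₁, γ′₀, 0]`): exactly the data `(γ, hγ2, hplane, hunit,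
  hhot, hν, hκ)` of `…RidgeHullValues.exists_hullLimit_crossSectionMax_const` ((Q3∞), `κ₀ = κ` when `κ > 0`) and of `…RidgeWebFermat.web_fermat`.
WHAT THIS IS NOT: not a claim about Navier–Stokes regularity — the branch parametrisation for the entrance of research cell (Q4) of the (TH) column of K2 (bears_on LADDER-NS N0,
item 20428 / crux 19708; 20428/19708/27893 OPEN).
-/

noncomputable section

-- the summit and its single sub-problem share the name (CONVENTIONS §1), as in every Theorems file
set_option linter.dupNamespace false

namespace Summit.NavierStokesRegularity.NavierStokesRegularity.Theorems.PoloidalWindowDoorLrcModEntireRidgeGlobalBranch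

open Set Filter Topology Metric Function
open scoped NNReal InnerProductSpace RealInnerProductSpace ContDiff
open Summit.NavierStokesRegularity.NavierStokesRegularity.Theorems.PoloidalWindowDoorLrcModEntireRidgeGlobalBranchODE
open Summit.NavierStokesRegularity.NavierStokesRegularity.Theorems.PoloidalWindowDoorLrcModEntireRidgeGlobalBranchFrame
open Summit.NavierStokesRegularity.NavierStokesRegularity.Theorems.PoloidalWindowDoorLrcModEntireRidgeGlobalBranchLocal
open Literature.Analysis Literature.Analysis.FluidPDE Literature.Analysis.UnboundedOperators
open Summit.NavierStokesRegularity.NavierStokesRegularity.Theorems.LocalSineTubeDoorProfileAlignedWindowRigidityAncient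
open Summit.NavierStokesRegularity.NavierStokesRegularity.Theorems.PoloidalWindowDoorLrcModEntireRidgeClass

variable {f : EuclideanSpace ℝ (Fin 3) → ℝ} {κ M : ℝ}

/-- **A kernel direction at a non-isolated critical point**: if every hot point is critical and `h` is not isolated in the hot set, some horizontal unit `T` has
`D²f(h)[T, ·] = 0` (a limit of unit secants `(yₖ − h)/‖yₖ − h‖`, `yₖ → h` hot, and `Df(yₖ) − Df(h) = D²f(h)(yₖ − h) + o(‖yₖ − h‖)` with both derivatives zero). -/
theorem exists_kernel_direction (hf : ContDiff ℝ 2 f)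
    (hcrit : ∀ y : EuclideanSpace ℝ (Fin 3), y 2 = 0 → f y = M → fderiv ℝ f y = 0)
    {h : EuclideanSpace ℝ (Fin 3)} (hh2 : h 2 = 0) (hhM : f h = M)
    (hni : ∀ r > 0, ∃ y' : EuclideanSpace ℝ (Fin 3), y' 2 = 0 ∧ f y' = M ∧ y' ≠ h ∧ dist y' h < r) :
    ∃ T : EuclideanSpace ℝ (Fin 3), T 2 = 0 ∧ ‖T‖ = 1 ∧ ∀ w, fderiv ℝ (fderiv ℝ f) h T w = 0 := by
  -- a sequence of hot points `y n → h`, `y n ≠ h`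
  choose y hy2 hyM hyne hyd using fun n : ℕ => hni (1 / ((n : ℝ) + 1)) (by positivity)
  have hyt : Tendsto y atTop (𝓝 h) := by
    rw [Metric.tendsto_atTop]
    intro ε hε
    obtain ⟨N, hN⟩ := exists_nat_one_div_lt hε
    refine ⟨N, fun n hn => (hyd n).trans (lt_of_le_of_lt ?_ hN)⟩
    gcongr
  -- unit secants and a convergent subsequence
  set u : ℕ → EuclideanSpace ℝ (Fin 3) := fun n => ‖y n - h‖⁻¹ • (y n - h) with hudef
  have hnorm : ∀ n, ‖y n - h‖ ≠ 0 := fun n => norm_ne_zero_iff.2 (sub_ne_zero.2 (hyne n))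
  have husphere : ∀ n, u n ∈ sphere (0 : EuclideanSpace ℝ (Fin 3)) 1 := fun n => by
    rw [mem_sphere_zero_iff_norm, hudef]
    simp only
    rw [norm_smul, norm_inv, norm_norm, inv_mul_cancel₀ (hnorm n)]
  obtain ⟨T, hTs, φ, hφ, hTlim⟩ := (isCompact_sphere (0 : EuclideanSpace ℝ (Fin 3)) 1).tendsto_subseq husphere
  refine ⟨T, ?_, by simpa using hTs, ?_⟩
  · -- horizontality passes to the limit
    have hc2 : Continuous fun x : EuclideanSpace ℝ (Fin 3) => x 2 := (EuclideanSpace.proj (2 : Fin 3)).continuous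
    have hlim := (hc2.tendsto T).comp hTlim
    have hzero : (fun n => (u (φ n)) 2) = fun _ => (0 : ℝ) := by
      funext n; simp [hudef, hy2, hh2]
    have hlim' : Tendsto (fun n => (u (φ n)) 2) atTop (𝓝 (T 2)) := hlim
    rw [hzero] at hlim'
    exact tendsto_nhds_unique hlim' tendsto_const_nhds
  · -- `D²f(h)(u n) → 0` from the little-o of `Df` at `h` (both `Df(y n)` and `Df(h)` vanish)
    have hD : HasFDerivAt (fderiv ℝ f) (fderiv ℝ (fderiv ℝ f) h) h :=
      (((hf.fderiv_right (m := 1) le_rfl).differentiable one_ne_zero) h).hasFDerivAt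
    have ht := (hasFDerivAt_iff_tendsto.1 hD).comp hyt
    have heq : (fun n => ‖y n - h‖⁻¹ * ‖fderiv ℝ f (y n) - fderiv ℝ f h - fderiv ℝ (fderiv ℝ f) h (y n - h)‖) =
        fun n => ‖fderiv ℝ (fderiv ℝ f) h (u n)‖ := by
      funext n
      rw [hcrit (y n) (hy2 n) (hyM n), hcrit h hh2 hhM, sub_zero, zero_sub, norm_neg, hudef]
      simp only
      rw [map_smul, norm_smul, norm_inv, norm_norm]
    have ht' : Tendsto (fun n => ‖fderiv ℝ (fderiv ℝ f) h (u n)‖) atTop (𝓝 0) := by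
      have := ht; rw [Function.comp_def] at this; simpa only [heq] using this
    have hsub : Tendsto (fun n => ‖fderiv ℝ (fderiv ℝ f) h (u (φ n))‖) atTop (𝓝 0) := ht'.comp hφ.tendsto_atTop
    have hcont : Continuous fun x => ‖fderiv ℝ (fderiv ℝ f) h x‖ := (fderiv ℝ (fderiv ℝ f) h).continuous.norm
    have hlim2 : Tendsto (fun n => ‖fderiv ℝ (fderiv ℝ f) h (u (φ n))‖) atTop (𝓝 ‖fderiv ℝ (fderiv ℝ f) h T‖) :=
      (hcont.tendsto T).comp hTlim
    have h0 : ‖fderiv ℝ (fderiv ℝ f) h T‖ = 0 := tendsto_nhds_unique hlim2 hsub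
    have hT0 : fderiv ℝ (fderiv ℝ f) h T = 0 := norm_eq_zero.1 h0
    intro w
    rw [hT0, zero_apply]

/-- **THE COMPLETE UNIT-SPEED HOT BRANCH through the hot spot.**  See the module docstring. -/
theorem exists_complete_hotBranch (hfa : AnalyticOnNhd ℝ f univ) {C₂ C₃ C₄ : ℝ}
    (hC₂ : ∀ x, ‖iteratedFDeriv ℝ 2 f x‖ ≤ C₂) (hC₃ : ∀ x, ‖iteratedFDeriv ℝ 3 f x‖ ≤ C₃) (hC₄ : ∀ x, ‖iteratedFDeriv ℝ 4 f x‖ ≤ C₄)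
    (hκ : κ ≠ 0) (h0M : f 0 = M)
    (hcrit : ∀ y : EuclideanSpace ℝ (Fin 3), y 2 = 0 → f y = M → fderiv ℝ f y = 0)
    (htr : ∀ y : EuclideanSpace ℝ (Fin 3), y 2 = 0 → f y = M → fderiv ℝ (fderiv ℝ f) y e0 e0 + fderiv ℝ (fderiv ℝ f) y e1 e1 = -κ)
    (hni : ∀ y : EuclideanSpace ℝ (Fin 3), y 2 = 0 → f y = M → ∀ r > 0,
      ∃ y' : EuclideanSpace ℝ (Fin 3), y' 2 = 0 ∧ f y' = M ∧ y' ≠ y ∧ dist y' y < r) :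
    ∃ γ : ℝ → EuclideanSpace ℝ (Fin 3), ContDiff ℝ 2 γ ∧ γ 0 = 0 ∧ (∀ s, γ s 2 = 0) ∧ (∀ s, f (γ s) = M) ∧
      (∀ s, ‖deriv γ s‖ = 1) ∧ (∀ s, deriv γ s 2 = 0) ∧ (∀ s w, fderiv ℝ (fderiv ℝ f) (γ s) (deriv γ s) w = 0) ∧
      ∀ s, fderiv ℝ (fderiv ℝ f) (γ s) (rotJ (deriv γ s)) (rotJ (deriv γ s)) = -κ := by
  have hf : ContDiff ℝ ω f := contDiff_iff_contDiffAt.2 fun x => (hfa x (mem_univ x)).contDiffAt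
  have hf4 : ContDiff ℝ 4 f := hf.of_le le_top
  have h02 : (0 : EuclideanSpace ℝ (Fin 3)) 2 = 0 := rfl
  -- initial direction and the global solution
  obtain ⟨T₀, hT₀2, hT₀1, hT₀ker⟩ := exists_kernel_direction (hf.of_le le_top) hcrit h02 h0M (hni 0 h02 h0M)
  obtain ⟨Y, hY0, hY⟩ := exists_global_solution (κ := κ) hf4 hC₂ hC₃ hC₄ ((0 : EuclideanSpace ℝ (Fin 3)), T₀)
  -- the good set
  set A : Set ℝ := {s | (Y s).1 2 = 0 ∧ f (Y s).1 = M ∧ (Y s).2 2 = 0 ∧ ‖(Y s).2‖ = 1 ∧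
    fderiv ℝ (fderiv ℝ f) (Y s).1 (Y s).2 = 0} with hA
  have hYc : Continuous Y := continuous_iff_continuousAt.2 fun s => (hY s).continuousAt
  have hY1c : Continuous fun s => (Y s).1 := continuous_fst.comp hYc
  have hY2c : Continuous fun s => (Y s).2 := continuous_snd.comp hYc
  have hclosed : IsClosed A := by
    have hc2 : Continuous fun x : EuclideanSpace ℝ (Fin 3) => x 2 := (EuclideanSpace.proj (2 : Fin 3)).continuous
    have hD2c : Continuous fun s => fderiv ℝ (fderiv ℝ f) (Y s).1 (Y s).2 := by
      have h1 : Continuous (fderiv ℝ (fderiv ℝ f)) := (hf.fderiv_right (m := 1) le_top).continuous_fderiv one_ne_zero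
      exact (h1.comp hY1c).clm_apply hY2c
    have e : A = {s | (Y s).1 2 = 0} ∩ ({s | f (Y s).1 = M} ∩ ({s | (Y s).2 2 = 0} ∩ ({s | ‖(Y s).2‖ = 1} ∩
        {s | fderiv ℝ (fderiv ℝ f) (Y s).1 (Y s).2 = 0}))) := by
      ext s; simp only [hA, mem_setOf_eq, mem_inter_iff]
    rw [e]
    exact (isClosed_eq (hc2.comp hY1c) continuous_const).inter ((isClosed_eq (hf.continuous.comp hY1c) continuous_const).inter
      ((isClosed_eq (hc2.comp hY2c) continuous_const).inter ((isClosed_eq (continuous_norm.comp hY2c) continuous_const).inter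
      (isClosed_eq hD2c continuous_const))))
  have hopen : IsOpen A := by
    rw [isOpen_iff_mem_nhds]
    intro s₀ hs₀
    obtain ⟨h1, h2, h3, h4, h5⟩ := hs₀
    obtain ⟨ε, hε, Z, hZ0, hZ⟩ := exists_local_good_solution hfa hκ hcrit htr hni h1 h2 h3 h4
      (fun w => by rw [h5, zero_apply]) s₀
    have hZ0' : Y s₀ = Z s₀ := by rw [hZ0]
    have heq : EqOn Y Z (Ioo (s₀ - ε) (s₀ + ε)) :=
      eqOn_of_solutions (κ := κ) hf4 hC₂ hC₃ hC₄ ⟨by linarith, by linarith⟩ (fun s _ => hY s) (fun s hs => (hZ s hs).1) hZ0'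
    have hI : Ioo (s₀ - ε) (s₀ + ε) ∈ 𝓝 s₀ := Ioo_mem_nhds (by linarith) (by linarith)
    refine mem_of_superset hI fun s hs => ?_
    obtain ⟨-, g1, g2, g3, g4, g5⟩ := hZ s hs
    rw [← heq hs] at g1 g2 g3 g4 g5
    exact ⟨g1, g2, g3, g4, by ext w; rw [g5 w, zero_apply]⟩
  have h0A : (0 : ℝ) ∈ A := by
    refine ⟨?_, ?_, ?_, ?_, ?_⟩ <;> simp only [hY0]
    · rfl
    · exact h0M
    · exact hT₀2
    · exact hT₀1
    · ext w; rw [hT₀ker w, zero_apply]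
  have hAu : A = univ := IsClopen.eq_univ ⟨hclosed, hopen⟩ ⟨0, h0A⟩
  have hgood : ∀ s, (Y s).1 2 = 0 ∧ f (Y s).1 = M ∧ (Y s).2 2 = 0 ∧ ‖(Y s).2‖ = 1 ∧ fderiv ℝ (fderiv ℝ f) (Y s).1 (Y s).2 = 0 :=
    fun s => by have : s ∈ A := by rw [hAu]; exact mem_univ s
                exact this
  -- ### the branch `γ = Y.1`, its derivative `Y.2`
  have hγd : ∀ s, HasDerivAt (fun s => (Y s).1) (Y s).2 s := fun s =>
    (hY s).hasFDerivAt.fst.hasDerivAt.congr_deriv (by simp [branchField, clip_of_norm_eq_one (hgood s).2.2.2.1])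
  have hed : ∀ s, HasDerivAt (fun s => (Y s).2) (accel f κ (Y s)) s := fun s =>
    (hY s).hasFDerivAt.snd.hasDerivAt.congr_deriv (by simp [branchField])
  have hderiv : deriv (fun s => (Y s).1) = fun s => (Y s).2 := funext fun s => (hγd s).deriv
  have hderiv2 : deriv (fun s => (Y s).2) = fun s => accel f κ (Y s) := funext fun s => (hed s).deriv
  obtain ⟨K, hK⟩ := lipschitzWith_branchField (κ := κ) hf4 hC₂ hC₃ hC₄
  have hacc : Continuous fun s => accel f κ (Y s) := (continuous_snd.comp hK.continuous).comp hYc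
  have he1 : ContDiff ℝ 1 fun s => (Y s).2 := by
    rw [contDiff_one_iff_deriv, hderiv2]
    exact ⟨fun s => (hed s).differentiableAt, hacc⟩
  have hγ2 : ContDiff ℝ 2 fun s => (Y s).1 := by
    rw [show (2 : WithTop ℕ∞) = 1 + 1 by norm_num, contDiff_succ_iff_deriv, hderiv]
    exact ⟨fun s => (hγd s).differentiableAt, fun h => absurd h (by simp), he1⟩
  refine ⟨fun s => (Y s).1, hγ2, by simp [hY0], fun s => (hgood s).1, fun s => (hgood s).2.1, fun s => ?_, fun s => ?_,
    fun s w => ?_, fun s => ?_⟩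
  · rw [hderiv]; exact (hgood s).2.2.2.1
  · rw [hderiv]; exact (hgood s).2.2.1
  · rw [hderiv]; simp only; rw [(hgood s).2.2.2.2, zero_apply]
  · rw [hderiv]; simp only
    have hft := frame_trace (fderiv ℝ (fderiv ℝ f) (Y s).1) (hgood s).2.2.1 (hgood s).2.2.2.1
    rw [(hgood s).2.2.2.2, zero_apply, zero_add, htr _ (hgood s).1 (hgood s).2.1] at hft
    exact hft

/-! ### Part 6: binder level (clauses of `stub_T2b` + the ridge law) -/

section binder

variable {C : ℝ} {v : ℝ → EuclideanSpace ℝ (Fin 3) → EuclideanSpace ℝ (Fin 3)}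

/-- **THE COMPLETE HOT BRANCH OF A NON-DEGENERATE (TH) RIDGE, binder level.**  See the module docstring. -/
theorem exists_complete_hotBranch_of_ridge (hdec : HasTypeITimeDecay C v) (hcont : ContinuousOn (uncurry v) (Iio (0 : ℝ) ×ˢ univ))
    (hmild : ∀ s t : ℝ, s < t → t < 0 → ∀ x, v t x = heatExtension (v s) (t - s) x - oseenDuhamel 1 s v v t x)
    (hdiv : ∀ t < 0, VectorCalculus.IsDivFree (v t))
    (hcrit : ∀ y ∈ {y : EuclideanSpace ℝ (Fin 3) | y 2 = 0 ∧ v (-1) y 2 = v (-1) 0 2}, fderiv ℝ (fun x => v (-1) x 2) y = 0)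
    (hiso : ∀ K O : Set (EuclideanSpace ℝ (Fin 3)), IsCompact K → K.Nonempty → K ⊆ {y : EuclideanSpace ℝ (Fin 3) | y 2 = 0 ∧ v (-1) y 2 = v (-1) 0 2} →
      IsOpen O → K ⊆ O → O ∩ {y : EuclideanSpace ℝ (Fin 3) | y 2 = 0 ∧ v (-1) y 2 = v (-1) 0 2} ⊆ K → False)
    {σ : ℝ} (hσ : σ = 1 ∨ σ = -1) {κ : ℝ} (hκ : κ ≠ 0)
    (hlap : ∀ y : EuclideanSpace ℝ (Fin 3), y 2 = 0 → v (-1) y 2 = v (-1) 0 2 →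
      fderiv ℝ (fderiv ℝ (fun x => σ * v (-1) x 2)) y (EuclideanSpace.single 0 1) (EuclideanSpace.single 0 1) +
        fderiv ℝ (fderiv ℝ (fun x => σ * v (-1) x 2)) y (EuclideanSpace.single 1 1) (EuclideanSpace.single 1 1) = -κ) :
    ∃ γ : ℝ → EuclideanSpace ℝ (Fin 3), ContDiff ℝ 2 γ ∧ γ 0 = 0 ∧ (∀ s, γ s 2 = 0) ∧ (∀ s, ‖deriv γ s‖ = 1) ∧ (∀ s, deriv γ s 2 = 0) ∧
      (∀ s, v (-1) (γ s) 2 = v (-1) 0 2) ∧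
      (∀ s, fderiv ℝ (fderiv ℝ (fun y => σ * v (-1) y 2)) (γ s) (WithLp.toLp 2 ![-(deriv γ s 1), deriv γ s 0, 0])
        (WithLp.toLp 2 ![-(deriv γ s 1), deriv γ s 0, 0]) = -κ) ∧
      (∀ s w, fderiv ℝ (fderiv ℝ (fun y => σ * v (-1) y 2)) (γ s) (deriv γ s) w = 0) := by
  have h1 : (-1 : ℝ) < 0 := by norm_num
  have hσ0 : σ ≠ 0 := by rcases hσ with rfl | rfl <;> norm_num
  set f : EuclideanSpace ℝ (Fin 3) → ℝ := fun y => σ * v (-1) y 2 with hfdef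
  set M : ℝ := σ * v (-1) 0 2 with hMdef
  -- analyticity and the KNSS bounds
  have hslice_an : AnalyticOnNhd ℝ (v (-1)) univ := analyticOnNhd_slice hcont (bdd_of_hasTypeITimeDecay hdec) hmild h1
  have hslice : ContDiff ℝ ∞ (v (-1)) := contDiffOn_univ.1 hslice_an.contDiffOn_of_completeSpace
  have hθan : AnalyticOnNhd ℝ (fun y => v (-1) y 2) univ := fun y hy =>
    ((EuclideanSpace.proj (𝕜 := ℝ) (2 : Fin 3)).analyticAt _).comp (hslice_an y hy)
  have hfa : AnalyticOnNhd ℝ f univ := fun x hx => analyticAt_const.mul (hθan x hx)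
  have hwdiv : ∀ t < 0, IsWeaklyDivFree (v t) := fun t ht =>
    VectorCalculus.IsDivFree.isWeaklyDivFree_holds (hdiv t ht)
      ((contDiffOn_univ.1 (analyticOnNhd_slice hcont (bdd_of_hasTypeITimeDecay hdec) hmild ht).contDiffOn_of_completeSpace).of_le
        (by exact WithTop.coe_le_coe.2 le_top))
  have hbound : ∀ k : ℕ, ∃ Ck : ℝ, ∀ x, ‖iteratedFDeriv ℝ k f x‖ ≤ Ck := fun k => by
    obtain ⟨K, hK⟩ := exists_norm_iteratedFDeriv_le_slice_of_hasTypeITimeDecay hdec hcont hmild hwdiv h1 k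
    exact ⟨K, fun x => (norm_iteratedFDeriv_signed_le hslice hσ k x).trans (hK x)⟩
  obtain ⟨C₂, hC₂⟩ := hbound 2
  obtain ⟨C₃, hC₃⟩ := hbound 3
  obtain ⟨C₄, hC₄⟩ := hbound 4
  -- the hot set in terms of `f`
  have hhot_iff : ∀ y : EuclideanSpace ℝ (Fin 3), f y = M ↔ v (-1) y 2 = v (-1) 0 2 := fun y => by
    simp only [hfdef, hMdef]; exact mul_right_inj' hσ0
  have hθd : Differentiable ℝ (fun y => v (-1) y 2) := fun y => (hθan y (mem_univ y)).differentiableAt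
  have hcritf : ∀ y : EuclideanSpace ℝ (Fin 3), y 2 = 0 → f y = M → fderiv ℝ f y = 0 := by
    intro y hy2 hyM
    have h := hcrit y ⟨hy2, (hhot_iff y).1 hyM⟩
    have e : f = fun x => σ * (fun x => v (-1) x 2) x := rfl
    rw [e, fderiv_const_mul (hθd y), h, smul_zero]
  have htrf : ∀ y : EuclideanSpace ℝ (Fin 3), y 2 = 0 → f y = M → fderiv ℝ (fderiv ℝ f) y e0 e0 + fderiv ℝ (fderiv ℝ f) y e1 e1 = -κ :=
    fun y hy2 hyM => hlap y hy2 ((hhot_iff y).1 hyM)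
  -- non-isolation from «no compact isolated hot piece» with `K = {y}`, `O = ball y r`
  have hni : ∀ y : EuclideanSpace ℝ (Fin 3), y 2 = 0 → f y = M → ∀ r > 0,
      ∃ y' : EuclideanSpace ℝ (Fin 3), y' 2 = 0 ∧ f y' = M ∧ y' ≠ y ∧ dist y' y < r := by
    intro y hy2 hyM r hr
    by_contra hcon
    push Not at hcon
    have hyH : y ∈ {y : EuclideanSpace ℝ (Fin 3) | y 2 = 0 ∧ v (-1) y 2 = v (-1) 0 2} := ⟨hy2, (hhot_iff y).1 hyM⟩
    refine hiso {y} (ball y r) isCompact_singleton (singleton_nonempty y) (singleton_subset_iff.2 hyH) isOpen_ball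
      (singleton_subset_iff.2 (mem_ball_self hr)) ?_
    rintro y' ⟨hy'b, hy'2, hy'v⟩
    rw [mem_singleton_iff]
    by_contra hne
    exact absurd (mem_ball.1 hy'b) (not_lt.2 (hcon y' hy'2 ((hhot_iff y').2 hy'v) hne))
  have h0M : f 0 = M := rfl
  obtain ⟨γ, hγ2, hγ0, hplane, hhot, hunit, hh2, hker, hnormal⟩ :=
    exists_complete_hotBranch hfa hC₂ hC₃ hC₄ hκ h0M hcritf htrf hni
  refine ⟨γ, hγ2, hγ0, hplane, hunit, hh2, fun s => (hhot_iff _).1 (hhot s), fun s => ?_, hker⟩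
  have e : (WithLp.toLp 2 ![-(deriv γ s 1), deriv γ s 0, 0] : EuclideanSpace ℝ (Fin 3)) = rotJ (deriv γ s) := rfl
  rw [e]
  exact hnormal s

end binder

end Summit.NavierStokesRegularity.NavierStokesRegularity.Theorems.PoloidalWindowDoorLrcModEntireRidgeGlobalBranch

end
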